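import Literature.IUT.LogThetaLattice.PacketLogVolumesHaarModelRelativeTensor
import Literature.IUT.LogThetaLattice.PacketLogVolumesHaarModelCapsulesDegree
import HarnessLib

/-!
# [IUTchIII] Proposition 3.9 (iii) for CAPSULES at the RELATIVE genuine model, II: the DEGREE clause — for an
# arithmetic line bundle `𝔍 = {J_v}_{v ∈ 𝕍_mod}` on `F_mod` placed in the factor `α` of the `A`-packets
# `⊕_{(v_β)} ⊗_β K_{v̲_β}` of `K ⊋ F_mod`, `μ^log_{A,𝕍_ℚ}(𝔍) = deg_{F_mod}(𝔍)/[F_mod:ℚ]` (`Prop39iii_degree` for every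
# `K ⊇ F_mod`, every section of places, every `A` with `|A| ≥ 2`, every label; abc-iut cell, layer L6, row REL39 part R3)

S. Mochizuki, *Inter-universal Teichmüller theory III*, kurims manuscript (May 2020), Proposition 3.9 (iii), p. 117
[claim: Mochizuki2012, status: disputed]: "in the case of elements of `(†𝓕⊛_mod)_α` that arise as the image of objects
"`𝔍 = {𝔍_v}_{v∈𝕍}`" of `(†𝓕⊛_𝔪𝔬𝔡)_α` [cf. Example 3.6, (ii); Proposition 3.7, (ii)], the global log-volume
`μ^log_{A,𝕍_ℚ}(𝔍)` is equal to the degree of the arithmetic line bundle determined by `𝔍` …, relative to a suitable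
normalization"; (i), p. 115: "the elements … of "`𝕄(−)`" given by the [products of the] integral structures … [have]
log-volume … equal to zero"; Remark 3.1.1 (ii), p. 94 (weights `1/((∏_α[K_{v_α}:(F_mod)_{v_α}])·Σ∏[(F_mod)_{w_α}:ℚ_{v_ℚ}])`);
[IUTchIV] Prop. 1.1 (p. 9) `p^{d_{I*}}·(R_I)^∼ ⊆ R_I`, Prop. 1.4 (i) (p. 13) `μ^log((R_I)^∼) = 0`.

WHAT THIS FILE ADDS. Part I (`PacketLogVolumesHaarModelRelativeTensor.lean`, this seat) built the relative genuine
`A`-packets — portions `⊗_β K_{v̲_β}` of `K ⊇ F_mod` at a section `v ↦ v̲` (campaign-S `PlaceSection`, archimedean lift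
`τ`), `relCapsulePacketLogVolume σ τ A` = `μ^log_{A,v_ℚ}` with d3's portion weights (= the printed weights × dimension,
`portionWeight_prime_eq_packetWeightTensor_rel_mul`), and the INVARIANCE clause. abc-iut-L6-d3's
`PacketLogVolumesHaarModelCapsulesDegree.lean` (p419946) is the DEGREE clause for capsules in the case `K = F_mod = F`.
Here the degree clause at the RELATIVE model, by transposition of d3's construction to the portions of `K`:
* `CapsuleDatum.Adm.comap` — an admissible region of a portion of `K` is one of the pulled-back portion (same carrier);
* the REGION OF `𝔍` IN THE LABEL `α` of the relative portion `π = (v_β)_β` (`relCapsuleIdealRegionAt` /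
  `relCapsuleIdealRegion`): at `v_ℚ = p`, `ι_α(ϖ_{v_α}^{-n_{v_α}})·(R_I)^∼ ⊆ ⊗_β K_{v̲_β}` — the integral structure
  `(R_I)^∼` of the portion of `K` (COMPACT for `|A| ≥ 2` by d3's `haar_normalizedPacket_pos_lt_top` = [IUTchIV]
  Prop. 1.1 for the completions of `K`, so `μ^log((R_I)^∼) = 0` is honest) multiplied in the factor `α` by the image of a
  GLOBAL generator `ϖ_{v_α}^{-n} ∈ F_mod^×` of `J_{v_α} = 𝔭_{v_α}^{-n}𝒪` (d3's `idealGenAt`) — i.e. `J_{v_α}·𝒪_{K_{v̲_α}}`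
  tensored with the other integral structures; at `∞`: the unit polydisc of `⊗_{β,ℝ}ℂ = ⊗_β K_{τ(w_β)}` dilated by
  `e^{t_{w_α}}` in the factor `α` (d3's `archIdealPortionRegion` for `K`);
* **`relPortionDatum_logVol_relCapsuleIdealRegionAt`**: its portion log-volume is d3's per-place term `idealTerm F 𝔍 (π α)`
  (`n·log q_v/[F_v:ℚ_p]` resp. `t`) — because the relative shift IS the absolute one (part I `relPortionDatum_shift_prime`:
  `(1/[K_{v̲}:ℚ_p])·log‖ϖ^{-n}‖_{K_{v̲}} = n·log q_v/n_v`, the factor `[K_{v̲}:F_v]` cancelling);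
* **`relCapsulePacketLogVolume_relCapsuleIdealRegionAt`**: at every `v_ℚ` the relative `A`-packet log-volume of
  `𝔍`-in-label-`α` EQUALS d3's `|A| = 1`, `K = F` packet log-volume of `𝔍` (p416411 `haarIdealRegion`), hence
  **`globalLogVolume_relCapsuleIdealRegion : μ^log_{A,𝕍_ℚ}(𝔍) = deg_F(𝔍)/[F:ℚ]`** (`= ndeg`) and
  **`prop39iii_degree_haarModelRelCapsules : Prop39iii_degree (relCapsulePacketLogVolume σ τ A)
  (relCapsuleIdealRegion σ τ A hA α) IdealFamily.deg`** with the normalisation constant `c = 1/[F_mod:ℚ]` — the SAME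
  constant as at `K = F_mod` (p416411, p419946): at the genuine model the "suitable normalization" depends neither on
  the capsule nor on `K ⊋ F_mod` nor on the section of places;
* both clauses together: `globalLogVolume_relCapsulePacketAction_relCapsuleIdealRegion`.

HONEST SCOPE. `|A| ≥ 2` (hypothesis `hA`; the `|A| = 1` relative degree clause belongs with the `|A| = 1` assembly of
part R2 of the row); `⊗_ℝ` of copies of `ℂ` at `∞` (faithful for totally complex `K`); the objects `𝔍` are families of
fractional ideals of `F_mod` / dilated discs (Example 3.6 (ii) objects — no Frobenioid is constructed; the region in
`K_{v̲}` is `J_v·𝒪_{K_{v̲}}` through a global generator); dimension-normalised log-volumes as in part I. Nothing here bears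
on [IUTchIII] Cor. 3.12 or takes a side; typed ≠ endorsed. Classical mathematics.
[cite: DupuyHilado2025, §3.7] [cite: Mochizuki2012, IUTchIV Prop. 1.1 p. 9]
-/

noncomputable section

namespace Literature.IUT.LogThetaLattice

open Literature.IUT.LogVolume Literature.NumberTheory.NumberFields NumberField IsDedekindDomain MeasureTheory Set
open scoped ENNReal NNReal

/-! ### Admissible regions of a pulled-back portion -/

namespace CapsuleDatum

variable {F K : Type} [Field F] [Field K] {A : Type}

/-- An admissible region of a portion `D` of the `A`-packet of `K` IS an admissible region of the pulled-back portion
`D.comap φ` (same carrier, same regions). [claim: Mochizuki2012, status: disputed] -/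
def Adm.comap {D : CapsuleDatum K A} (φ : F →+* K) (T : D.Adm) : (D.comap φ).Adm := ⟨T.1, T.2⟩

/-- Its log-volume is unchanged. [claim: Mochizuki2012, status: disputed] -/
@[simp] theorem logVol_admComap {D : CapsuleDatum K A} (φ : F →+* K) (T : D.Adm) :
    (D.comap φ).logVol (Adm.comap φ T).1 = D.logVol T.1 := rfl

end CapsuleDatum

variable {F K : Type} [Field F] [NumberField F] [Field K] [NumberField K] [Algebra F K]
  (σ : PlaceSection F K) (τ : InfinitePlace F → InfinitePlace K) (hτ : ∀ w, (τ w).comap (algebraMap F K) = w)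
variable (A : Type) [Fintype A] [DecidableEq A] [Nonempty A] (hA : 2 ≤ Fintype.card A)

/-! ### The region of `𝔍` in the label `α` of the relative portions -/

/-- **The region of `𝔍 = {J_v}` (an arithmetic line bundle on `F_mod`, d3's `IdealFamily F`) in the label `α` of the
relative portion `π` at `v_ℚ`**: at `p`, `ι_α(ϖ_{v_α}^{-n_{v_α}})·(R_I)^∼ ⊆ ⊗_β K_{v̲_β}` (the integral structure of the
portion of `K`, multiplied in the factor `α` by the image of the global generator `ϖ_{v_α}^{-n} ∈ F_mod^×` through
`F_mod → K → K_{v̲_α}`); at `∞`, the unit polydisc of `⊗_{β,ℝ}ℂ` dilated by `e^{t_{w_α}}` in the factor `α`.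
[claim: Mochizuki2012, status: disputed] -/
def relCapsuleIdealRegionAt (α : A) (J : IdealFamily F) :
    (q : RatPlace) → (π : Portion F A q) → (relPortionDatum σ τ A q π).Adm
  | Sum.inl (), π =>
      CapsuleDatum.Adm.comap (algebraMap F K)
        (archIdealPortionRegion K A (fun β => τ (packetInftyEquiv F (π β))) α (J.arch (packetInftyEquiv F (π α))))
  | Sum.inr p, π =>
      haveI : Fact (p : ℕ).Prime := ⟨p.2⟩
      (relPortionDatum σ τ A (RatPlace.prime p) π).actAdm α
        (idealGenAt F (packetPrimeEquiv F p (π α)).1 (J.fin (packetPrimeEquiv F p (π α)).1))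
        (CapsuleDatum.Adm.comap (algebraMap F K)
          (nonarchUnitRegion K A p (liftTuple σ A p (fun β => packetPrimeEquiv F p (π β))) hA))

/-- **Its portion log-volume is d3's per-place term at `π(α)`** (`t_{w_α}` at `∞`; at `p`:
`μ^log((R_I)^∼) + shift^rel_π(α, ϖ^{-n}) = 0 + θ_{v_α}(ϖ^{-n}) = n·log q_{v_α}/n_{v_α}` by part I's
`relPortionDatum_shift_prime` and d3's `log_adicAbv_idealGenAt`). [claim: Mochizuki2012, status: disputed] -/
theorem relPortionDatum_logVol_relCapsuleIdealRegionAt (α : A) (J : IdealFamily F) (q : RatPlace) (π : Portion F A q) :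
    (relPortionDatum σ τ A q π).logVol (relCapsuleIdealRegionAt σ τ A hA α J q π).1 = idealTerm F J (π α).1 := by
  rcases q with ⟨⟩ | p
  · show ((archPortion K A _).comap (algebraMap F K)).logVol
      (CapsuleDatum.Adm.comap (algebraMap F K) (archIdealPortionRegion K A _ α _)).1 = _
    rw [CapsuleDatum.logVol_admComap, archPortion_logVol_idealPortionRegion]
    generalize π α = v
    rcases v with ⟨w | w, h⟩
    · rfl
    · exact absurd h (ratPlaceBelow_inr_ne_infty F w)
  · haveI : Fact (p : ℕ).Prime := ⟨p.2⟩
    show (relPortionDatum σ τ A (RatPlace.prime p) π).logVol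
      ((relPortionDatum σ τ A (RatPlace.prime p) π).actAdm α _ (CapsuleDatum.Adm.comap (algebraMap F K)
        (nonarchUnitRegion K A p (liftTuple σ A p (fun β => packetPrimeEquiv F p (π β))) hA))).1 = _
    rw [CapsuleDatum.logVol_actAdm, relPortionDatum_shift_prime]
    rw [show (relPortionDatum σ τ A (RatPlace.prime p) π).logVol (CapsuleDatum.Adm.comap (algebraMap F K)
        (nonarchUnitRegion K A p (liftTuple σ A p (fun β => packetPrimeEquiv F p (π β))) hA)).1 = 0 from
      nonarchPortion_logVol_unitRegion K A p _ hA, zero_add]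
    generalize π α = v
    rcases v with ⟨w | w, h⟩
    · exact absurd h (ratPlaceBelow_inl_ne_prime F w p)
    · show Real.log (NumberField.HeightOneSpectrum.adicAbv F w (idealGenAt F w (J.fin w) : F)) / (localDegree F w : ℝ) =
        (J.fin w : ℝ) * logNorm F w / localDegree F w
      rw [log_adicAbv_idealGenAt]

/-- **At every `v_ℚ` the relative `A`-packet log-volume of `𝔍`-in-label-`α` equals d3's `|A| = 1`, `K = F` packet
log-volume of `𝔍`** (p416411's `haarIdealRegion`): `Σ_π (∏_β ω(π β))·term(π α) = Σ_v ω_v·term_v = Σ_v c_v·μ^log_v(J_v)`.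
[claim: Mochizuki2012, status: disputed] -/
theorem relCapsulePacketLogVolume_relCapsuleIdealRegionAt (α : A) (J : IdealFamily F) (q : RatPlace) :
    relCapsulePacketLogVolume σ τ A q (relCapsuleIdealRegionAt σ τ A hA α J q) =
      haarPacketLogVolume F q ((haarIdealRegion F J).1 q) := by
  unfold relCapsulePacketLogVolume portionWeight
  simp_rw [relPortionDatum_logVol_relCapsuleIdealRegionAt]
  rw [sum_pi_prod_mul_apply A (fun v : Packet F q => placeProbWeight F v.1) (fun v => idealTerm F J v.1)
    (sum_packet_placeProbWeight F q) α]
  simp only [haarPacketLogVolume, haarIdealRegion_apply]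
  exact Finset.sum_congr rfl fun v _ => placeProbWeight_mul_idealTerm F J v.1

/-- At every `v_ℚ` it also equals d3's ABSOLUTE capsule log-volume of `𝔍`-in-label-`α` (p419946): the relative and the
absolute genuine `A`-packets give `𝔍` the same packet log-volumes. [claim: Mochizuki2012, status: disputed] -/
theorem relCapsulePacketLogVolume_relCapsuleIdealRegionAt_eq_capsule (α : A) (J : IdealFamily F) (q : RatPlace) :
    relCapsulePacketLogVolume σ τ A q (relCapsuleIdealRegionAt σ τ A hA α J q) =
      capsulePacketLogVolume F A q (capsuleIdealRegionAt F A hA α J q) := by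
  rw [relCapsulePacketLogVolume_relCapsuleIdealRegionAt, capsulePacketLogVolume_capsuleIdealRegionAt]

/-! ### The global region of `𝔍` and the degree clause -/

/-- **The region of `𝔍` in the label `α`** as a GLOBAL region of the relative `A`-packets ("zero log-volume for all but
finitely many `v_ℚ`": its packet log-volumes are those of p416411's `haarIdealRegion`). [claim: Mochizuki2012, status: disputed] -/
def relCapsuleIdealRegion (α : A) (J : IdealFamily F) : GlobalRegion (relCapsulePacketLogVolume σ τ A) :=
  ⟨relCapsuleIdealRegionAt σ τ A hA α J, by
    have h := (haarIdealRegion F J).2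
    refine h.subset fun q hq => ?_
    rw [Function.mem_support, relCapsulePacketLogVolume_relCapsuleIdealRegionAt] at hq
    exact Function.mem_support.mpr hq⟩

/-- Components of the global region of `𝔍`. [claim: Mochizuki2012, status: disputed] -/
@[simp] theorem relCapsuleIdealRegion_apply (α : A) (J : IdealFamily F) (q : RatPlace) :
    (relCapsuleIdealRegion σ τ A hA α J).1 q = relCapsuleIdealRegionAt σ τ A hA α J q := rfl

/-- **`μ^log_{A,𝕍_ℚ}(𝔍)` at the relative model `= μ^log_{𝕍_ℚ}(𝔍)` at d3's `|A| = 1`, `K = F` model.**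
[claim: Mochizuki2012, status: disputed] -/
theorem globalLogVolume_relCapsuleIdealRegion_eq (α : A) (J : IdealFamily F) :
    globalLogVolume (relCapsulePacketLogVolume σ τ A) (relCapsuleIdealRegion σ τ A hA α J) =
      globalLogVolume (haarPacketLogVolume F) (haarIdealRegion F J) := by
  unfold globalLogVolume
  exact finsum_congr fun q => relCapsulePacketLogVolume_relCapsuleIdealRegionAt σ τ A hA α J q

/-- **`μ^log_{A,𝕍_ℚ}(𝔍) = deg_F(𝔍)/[F:ℚ]`** at the relative genuine `A`-packets, for every `K ⊇ F_mod`, every section, every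
`A` (`|A| ≥ 2`) and every label `α` (p416411 `globalLogVolume_haarIdealRegion`). [claim: Mochizuki2012, status: disputed] -/
theorem globalLogVolume_relCapsuleIdealRegion (α : A) (J : IdealFamily F) :
    globalLogVolume (relCapsulePacketLogVolume σ τ A) (relCapsuleIdealRegion σ τ A hA α J) =
      J.deg / Module.finrank ℚ F := by
  rw [globalLogVolume_relCapsuleIdealRegion_eq, globalLogVolume_haarIdealRegion]

/-- The same with the tree's normalised degree `ndeg` ([IUTchIV] Def. 1.9 (i)): `μ^log_{A,𝕍_ℚ}(𝔍) = deg(𝔞_𝔍)` on the nose.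
[claim: Mochizuki2012, status: disputed] -/
theorem globalLogVolume_relCapsuleIdealRegion_eq_ndeg (α : A) (J : IdealFamily F) :
    globalLogVolume (relCapsulePacketLogVolume σ τ A) (relCapsuleIdealRegion σ τ A hA α J) = ndeg F J.toADivisor := by
  rw [globalLogVolume_relCapsuleIdealRegion_eq, globalLogVolume_haarIdealRegion_eq_ndeg]

/-- **IUTchIII:Prop3.9(iii)** (kurims p. 117) DEGREE CLAUSE AT THE RELATIVE GENUINE MODEL FOR CAPSULES (row REL39 part R3;
node IUTchIII:Prop3.9(iii)): for every extension of number fields `K ⊇ F_mod`, every section of places, every finite label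
set `A` with `|A| ≥ 2` and every label `α ∈ A`, abc-iut-L6-t4's `Prop39iii_degree (relCapsulePacketLogVolume σ τ A)
(relCapsuleIdealRegion σ τ A hA α) IdealFamily.deg` HOLDS with the normalisation constant `c = 1/[F_mod:ℚ]` — the SAME
constant as at `K = F_mod` (p416411, p419946): "the global log-volume `μ^log_{A,𝕍_ℚ}(𝔍)` is equal to the degree of the
arithmetic line bundle determined by `𝔍` …, relative to a suitable normalization", the normalization being independent of
`K`, of the section and of the capsule. [claim: Mochizuki2012, status: disputed] -/
theorem prop39iii_degree_haarModelRelCapsules (α : A) :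
    Prop39iii_degree (relCapsulePacketLogVolume σ τ A) (relCapsuleIdealRegion σ τ A hA α) IdealFamily.deg :=
  ⟨1 / Module.finrank ℚ F, div_pos one_pos (FinDivisor.finrank_pos (F := F)), fun J => by
    rw [globalLogVolume_relCapsuleIdealRegion, one_div, ← div_eq_inv_mul]⟩

/-- The unit family `𝒪 = {𝒪_v}` in any label has global log-volume `0` at the relative model ("the log-volume of [the
integral structures] … is equal to zero", Prop. 3.9 (i)). [claim: Mochizuki2012, status: disputed] -/
theorem globalLogVolume_relCapsuleIdealRegion_unit (α : A) :
    globalLogVolume (relCapsulePacketLogVolume σ τ A) (relCapsuleIdealRegion σ τ A hA α IdealFamily.unit) = 0 := by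
  rw [globalLogVolume_relCapsuleIdealRegion_eq, globalLogVolume_haarIdealRegion_unit]

/-- Relative models with the degree clause exist for every `K ⊇ F_mod` (sections of places exist).
[claim: Mochizuki2012, status: disputed] -/
theorem exists_prop39iii_degree_haarModelRelCapsules (α : A) :
    ∃ (σ : PlaceSection F K) (τ : InfinitePlace F → InfinitePlace K),
      (∀ w, (τ w).comap (algebraMap F K) = w) ∧
      Prop39iii_degree (relCapsulePacketLogVolume σ τ A) (relCapsuleIdealRegion σ τ A hA α) IdealFamily.deg := by
  obtain ⟨σ'⟩ := PlaceSection.nonempty F K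
  exact ⟨σ', fun w => (InfinitePlace.comap_surjective (K := K) w).choose,
    fun w => (InfinitePlace.comap_surjective (K := K) w).choose_spec,
    prop39iii_degree_haarModelRelCapsules σ' _ A hA α⟩

include hτ in
/-- **Both clauses of Prop. 3.9 (iii) together at the relative genuine capsule model**: multiplying the region of `𝔍` in the
label `β` by `f ∈ F_mod^×` in ANY label `γ` leaves its global log-volume `deg_F(𝔍)/[F:ℚ]` unchanged (part I
`prop39iii_invariance_haarModelRelCapsules`). [claim: Mochizuki2012, status: disputed] -/
theorem globalLogVolume_relCapsulePacketAction_relCapsuleIdealRegion (β γ : A) (f : Fˣ) (J : IdealFamily F) :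
    globalLogVolume (relCapsulePacketLogVolume σ τ A)
        (relCapsulePacketAction σ τ hτ A γ f (relCapsuleIdealRegion σ τ A hA β J)) = J.deg / Module.finrank ℚ F := by
  rw [globalLogVolume_relCapsulePacketAction, globalLogVolume_relCapsuleIdealRegion]

end Literature.IUT.LogThetaLattice

end
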